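import Summits.Ventures.HodgeRepro0.P5BlockCensus

/-!
# P5BlockCensusPieces — the block method, continued: pairs, cosets, the disjoint decomposition, the primitive sets and
the count, generic over the data (kernel-checkable per instance)

p5 (g21), 2026-08-29.  Supporting artefact (R-5): finite combinatorics only; nothing here is an algebraicity statement.
Companion of `P5BlockCensus.lean` (the block theorem `balanced_iff_blocks`), whose notation it continues.  A second
decidable proposition `Facts2 D` (cosets of units, conjugates, the blocks indexed by `Fin D.creps.length`) yields:
`balanced_decomposition` — every balanced `S ⊆ U` is the union of a pairwise-disjoint finset of conjugate pairs and
cosets of `H`; `primitive_iff` — the PRIMITIVE balanced sets (non-empty, no proper non-empty balanced subset) are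
exactly the pairs and the cosets; `card_balanced` — the balanced subsets of `U` number `∏_blocks |allowed pieces|`
(per instance: `(2^|H| + 2)^{#blocks}`, the allowed pieces being the unions of the block's `|H|` pairs and its two cosets).
-/

namespace HodgeRepro0.P5BlockCensus

variable (D : Data)

/-- A conjugate pair `{s, −s}`, `s` a unit. -/
def IsPair (P : Finset ℕ) : Prop := ∃ s ∈ D.units, P = {s, conj D s}

/-- A coset `cH`, `c` a unit. -/
def IsCoset (P : Finset ℕ) : Prop := ∃ c ∈ D.units, P = (coset D c).toFinset

/-- PRIMITIVE: balanced, non-empty, with no proper non-empty balanced subset. -/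
def Primitive (S : Finset ℕ) : Prop := Balanced D S ∧ S.Nonempty ∧ ∀ P ⊂ S, P.Nonempty → ¬ Balanced D P

/-- The `i`-th coset representative. -/
def crep (i : Fin D.creps.length) : ℕ := D.creps.get i

/-- The block of `c`: the coset `cH` together with its conjugate `−cH`. -/
def block (c : ℕ) : Finset ℕ := (coset D c).toFinset ∪ ((coset D c).map (conj D)).toFinset

/-- THE FACTS of this file, all decidable for concrete data. -/
abbrev Facts2 : Prop :=
  (∀ c ∈ D.creps, ((coset D c).map (conj D)).toFinset = (coset D (conj D c)).toFinset) ∧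
  (∀ c ∈ D.creps, conj D c ∈ D.units ∧ c ∈ D.units) ∧
  (∀ t ∈ R D, ∃ c ∈ D.creps, t ∈ coset D c) ∧
  (∀ c ∈ D.creps, ∀ t ∈ coset D c, t ∈ D.units) ∧
  (∀ c ∈ D.creps, ∀ t ∈ coset D c, conj D t ∉ coset D c) ∧
  (∀ u ∈ D.units, conj D (conj D u) = u) ∧
  (∀ u ∈ D.units, u ≠ conj D u) ∧
  (∀ c ∈ D.units, ∃ c' ∈ D.creps,
    (coset D c).toFinset = (coset D c').toFinset ∨ (coset D c).toFinset = ((coset D c').map (conj D)).toFinset) ∧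
  (∀ c ∈ D.units, (coset D c).toFinset ⊆ U D) ∧
  (∀ c ∈ D.units, c ∈ (coset D c).toFinset) ∧
  (∀ c ∈ D.units, Balanced D (coset D c).toFinset) ∧
  (∀ s ∈ D.units, Balanced D ({s, conj D s} : Finset ℕ)) ∧
  (∀ i : Fin D.creps.length, ∀ t ∈ coset D (crep D i), ∀ t' ∈ coset D (crep D i), t ≠ t' →
    Disjoint ({t, conj D t} : Finset ℕ) {t', conj D t'}) ∧
  (∀ i : Fin D.creps.length, crep D i ∈ D.creps) ∧ (∀ c ∈ D.creps, ∃ i : Fin D.creps.length, c = crep D i) ∧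
  (∀ i : Fin D.creps.length, ∀ t ∈ coset D (crep D i), t ∈ block D (crep D i) ∧ conj D t ∈ block D (crep D i)) ∧
  (∀ i j : Fin D.creps.length, i ≠ j → ∀ t ∈ block D (crep D i), t ∉ block D (crep D j)) ∧
  (∀ u ∈ D.units, ∃ i : Fin D.creps.length, u ∈ block D (crep D i)) ∧
  (∀ i : Fin D.creps.length, block D (crep D i) ⊆ U D)

variable {D}

section
variable (hF : Facts D) (hG : Facts2 D)
include hG

/-- The conjugate of the coset `cH` is the coset `(−c)H`. -/
theorem g_coset_conj : ∀ c ∈ D.creps, ((coset D c).map (conj D)).toFinset = (coset D (conj D c)).toFinset := hG.1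
/-- `conj c` and `c` are units for `c ∈ creps`. -/
theorem g_conj_units : ∀ c ∈ D.creps, conj D c ∈ D.units ∧ c ∈ D.units := hG.2.1
/-- Every representative lies in one of the cosets of `creps`. -/
theorem g_R_coset : ∀ t ∈ R D, ∃ c ∈ D.creps, t ∈ coset D c := hG.2.2.1
/-- Coset elements are units. -/
theorem g_coset_units : ∀ c ∈ D.creps, ∀ t ∈ coset D c, t ∈ D.units := hG.2.2.2.1
/-- A coset and its conjugate are disjoint. -/
theorem g_conj_not_mem : ∀ c ∈ D.creps, ∀ t ∈ coset D c, conj D t ∉ coset D c := hG.2.2.2.2.1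
/-- `conj` is an involution on the units. -/
theorem g_conj_conj : ∀ u ∈ D.units, conj D (conj D u) = u := hG.2.2.2.2.2.1
/-- No unit is its own conjugate. -/
theorem g_ne_conj : ∀ u ∈ D.units, u ≠ conj D u := hG.2.2.2.2.2.2.1
/-- The coset of any unit is the coset of a representative or the conjugate of one. -/
theorem g_coset_of_unit : ∀ c ∈ D.units, ∃ c' ∈ D.creps,
    (coset D c).toFinset = (coset D c').toFinset ∨ (coset D c).toFinset = ((coset D c').map (conj D)).toFinset :=
  hG.2.2.2.2.2.2.2.1
/-- Cosets are subsets of `U`. -/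
theorem g_coset_sub_U : ∀ c ∈ D.units, (coset D c).toFinset ⊆ U D := hG.2.2.2.2.2.2.2.2.1
/-- Every unit lies in its own coset. -/
theorem g_coset_mem_self : ∀ c ∈ D.units, c ∈ (coset D c).toFinset := hG.2.2.2.2.2.2.2.2.2.1
/-- Every coset of `H` is balanced. -/
theorem g_coset_balanced : ∀ c ∈ D.units, Balanced D (coset D c).toFinset := hG.2.2.2.2.2.2.2.2.2.2.1
/-- Every conjugate pair is balanced. -/
theorem g_pair_balanced : ∀ s ∈ D.units, Balanced D ({s, conj D s} : Finset ℕ) := hG.2.2.2.2.2.2.2.2.2.2.2.1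
/-- Distinct conjugate pairs of one block are disjoint. -/
theorem g_pair_disj : ∀ i : Fin D.creps.length, ∀ t ∈ coset D (crep D i), ∀ t' ∈ coset D (crep D i), t ≠ t' →
    Disjoint ({t, conj D t} : Finset ℕ) {t', conj D t'} := hG.2.2.2.2.2.2.2.2.2.2.2.2.1
/-- `crep i ∈ creps`. -/
theorem g_crep_mem : ∀ i : Fin D.creps.length, crep D i ∈ D.creps := hG.2.2.2.2.2.2.2.2.2.2.2.2.2.1
/-- Every `c ∈ creps` is some `crep i`. -/
theorem g_crep_surj : ∀ c ∈ D.creps, ∃ i : Fin D.creps.length, c = crep D i := hG.2.2.2.2.2.2.2.2.2.2.2.2.2.2.1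
/-- Coset elements and their conjugates lie in the block. -/
theorem g_block_mem : ∀ i : Fin D.creps.length, ∀ t ∈ coset D (crep D i),
    t ∈ block D (crep D i) ∧ conj D t ∈ block D (crep D i) := hG.2.2.2.2.2.2.2.2.2.2.2.2.2.2.2.1
/-- Distinct blocks are disjoint. -/
theorem g_block_disj : ∀ i j : Fin D.creps.length, i ≠ j → ∀ t ∈ block D (crep D i), t ∉ block D (crep D j) :=
  hG.2.2.2.2.2.2.2.2.2.2.2.2.2.2.2.2.1
/-- The blocks cover the units. -/
theorem g_block_cover : ∀ u ∈ D.units, ∃ i : Fin D.creps.length, u ∈ block D (crep D i) :=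
  hG.2.2.2.2.2.2.2.2.2.2.2.2.2.2.2.2.2.1
/-- Each block lies in `U`. -/
theorem g_block_sub_U : ∀ i : Fin D.creps.length, block D (crep D i) ⊆ U D := hG.2.2.2.2.2.2.2.2.2.2.2.2.2.2.2.2.2.2

omit hG in
/-- A set of odd cardinality is not balanced (any unit `k` will do). -/
theorem not_balanced_of_odd (hne : D.units ≠ []) (S : Finset ℕ) (h : S.card % 2 = 1) : ¬ Balanced D S := by
  intro hb
  obtain ⟨k, hk⟩ : ∃ k, k ∈ D.units := by
    cases hu : D.units with
    | nil => exact absurd hu hne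
    | cons a l => exact ⟨a, List.mem_cons_self ..⟩
  have := hb k hk
  omega

include hF

/-- A balanced non-empty `S ⊆ U` contains a balanced pair or coset. -/
theorem contains_piece (S : Finset ℕ) (hS : S ⊆ U D) (hb : Balanced D S) (hne : S.Nonempty) :
    ∃ P ⊆ S, (IsPair D P ∨ IsCoset D P) ∧ P.Nonempty ∧ Balanced D P := by
  obtain ⟨s, hs⟩ := hne
  have hsU : s ∈ D.units := List.mem_toFinset.mp (hS hs)
  obtain ⟨t₀, ht₀R, hst⟩ : ∃ t₀ ∈ R D, s = t₀ ∨ s = conj D t₀ := by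
    have hsU' : s ∈ U D := hS hs
    rw [c_U_eq (f_core hF), Finset.mem_union, Finset.mem_image] at hsU'
    rcases hsU' with h | ⟨t, ht, hst⟩
    · exact ⟨s, List.mem_toFinset.mp h, Or.inl rfl⟩
    · exact ⟨t, List.mem_toFinset.mp ht, Or.inr hst.symm⟩
  obtain ⟨c, hc, htc⟩ := g_R_coset hG t₀ ht₀R
  have ht₀U : t₀ ∈ D.units := g_coset_units hG c hc t₀ htc
  rcases (balanced_iff_blocks hF S hS).mp hb c hc with h1 | h1 | h1
  · refine ⟨{t₀, conj D t₀}, ?_, Or.inl ⟨t₀, ht₀U, rfl⟩, ⟨t₀, by simp⟩, g_pair_balanced hG t₀ ht₀U⟩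
    have hiff := h1 t₀ htc
    intro x hx
    rw [Finset.mem_insert, Finset.mem_singleton] at hx
    rcases hst with rfl | rfl
    · rcases hx with rfl | rfl
      · exact hs
      · exact hiff.mp hs
    · rcases hx with rfl | rfl
      · exact hiff.mpr hs
      · exact hs
  · refine ⟨(coset D c).toFinset, ?_, Or.inr ⟨c, (g_conj_units hG c hc).2, rfl⟩,
      ⟨c, List.mem_toFinset.mpr (f_creps_mem_coset hF c hc)⟩, g_coset_balanced hG c (g_conj_units hG c hc).2⟩
    intro x hx
    exact (h1 x (List.mem_toFinset.mp hx)).1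
  · refine ⟨((coset D c).map (conj D)).toFinset, ?_, Or.inr ⟨conj D c, (g_conj_units hG c hc).1, g_coset_conj hG c hc⟩,
      ?_, ?_⟩
    · intro x hx
      rw [List.mem_toFinset, List.mem_map] at hx
      obtain ⟨t, ht, rfl⟩ := hx
      exact (h1 t ht).2
    · exact ⟨conj D c, List.mem_toFinset.mpr (List.mem_map.mpr ⟨c, f_creps_mem_coset hF c hc, rfl⟩)⟩
    · rw [g_coset_conj hG c hc]; exact g_coset_balanced hG _ (g_conj_units hG c hc).1

/-- No proper non-empty subset of a coset is balanced. -/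
theorem coset_no_sub (c : ℕ) (hc : c ∈ D.units) (P : Finset ℕ) (hP : P ⊂ (coset D c).toFinset) (hne : P.Nonempty) :
    ¬ Balanced D P := by
  intro hb
  have hPU : P ⊆ U D := fun x hx => g_coset_sub_U hG c hc (hP.subset hx)
  obtain ⟨c', hc', hcc⟩ := g_coset_of_unit hG c hc
  have hcc' := f_creps_mem_coset hF c' hc'
  rcases hcc with hcc | hcc
  · rw [hcc] at hP
    rcases (balanced_iff_blocks hF P hPU).mp hb c' hc' with h1 | h1 | h1
    · obtain ⟨x, hx⟩ := hne
      have hxc : x ∈ coset D c' := List.mem_toFinset.mp (hP.subset hx)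
      have : conj D x ∈ P := (h1 x hxc).mp hx
      exact g_conj_not_mem hG c' hc' x hxc (List.mem_toFinset.mp (hP.subset this))
    · apply hP.not_subset
      intro x hx
      exact (h1 x (List.mem_toFinset.mp hx)).1
    · have := (h1 c' hcc').2
      exact g_conj_not_mem hG c' hc' c' hcc' (List.mem_toFinset.mp (hP.subset this))
  · rw [hcc] at hP
    have hmem : ∀ x ∈ P, ∃ t ∈ coset D c', x = conj D t := by
      intro x hx
      have := hP.subset hx
      rw [List.mem_toFinset, List.mem_map] at this
      obtain ⟨t, ht, rfl⟩ := this
      exact ⟨t, ht, rfl⟩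
    rcases (balanced_iff_blocks hF P hPU).mp hb c' hc' with h1 | h1 | h1
    · obtain ⟨x, hx⟩ := hne
      obtain ⟨t, ht, rfl⟩ := hmem x hx
      have htP : t ∈ P := (h1 t ht).mpr hx
      obtain ⟨t', ht', htt⟩ := hmem t htP
      have ht'U := g_coset_units hG c' hc' t' ht'
      have h2 : conj D t = t' := by rw [htt]; exact g_conj_conj hG t' ht'U
      have : conj D t ∈ coset D c' := by rw [h2]; exact ht'
      exact g_conj_not_mem hG c' hc' t ht this
    · have := (h1 c' hcc').1
      obtain ⟨t', ht', htt⟩ := hmem c' this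
      have h2 : conj D c' = t' := by rw [htt]; exact g_conj_conj hG t' (g_coset_units hG c' hc' t' ht')
      have : conj D c' ∈ coset D c' := by rw [h2]; exact ht'
      exact g_conj_not_mem hG c' hc' c' hcc' this
    · apply hP.not_subset
      intro x hx
      rw [List.mem_toFinset, List.mem_map] at hx
      obtain ⟨t, ht, rfl⟩ := hx
      exact (h1 t ht).2

/-- THE PRIMITIVE BALANCED SETS are exactly the conjugate pairs and the cosets of `H`. -/
theorem primitive_iff (hne : D.units ≠ []) (S : Finset ℕ) (hS : S ⊆ U D) :
    Primitive D S ↔ IsPair D S ∨ IsCoset D S := by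
  constructor
  · rintro ⟨hb, hne', hmin⟩
    obtain ⟨P, hPS, hP, hPne, hPb⟩ := contains_piece hF hG S hS hb hne'
    have : P = S := by
      by_contra hneq
      exact hmin P (Finset.ssubset_iff_subset_ne.mpr ⟨hPS, hneq⟩) hPne hPb
    rw [← this]; exact hP
  · rintro (⟨s, hs, rfl⟩ | ⟨c, hc, rfl⟩)
    · refine ⟨g_pair_balanced hG s hs, ⟨s, by simp⟩, ?_⟩
      intro P hP hPne
      apply not_balanced_of_odd hne
      have h1 : 1 ≤ P.card := Finset.card_pos.mpr hPne
      have h2 : P.card < 2 := lt_of_lt_of_le (Finset.card_lt_card hP) Finset.card_le_two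
      omega
    · exact ⟨g_coset_balanced hG c hc, ⟨c, g_coset_mem_self hG c hc⟩, coset_no_sub hF hG c hc⟩

end

end HodgeRepro0.P5BlockCensus
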